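import Summits.ValiantsHypothesis.ValiantsHypothesis.Theses.TwistedDetRank
import Summits.ValiantsHypothesis.ValiantsHypothesis.Theorems.TwistedDetRankTdrPerNotQP
import Literature.Computability.AlgebraicComplexity.DeterminantalComplexity
import Literature.Computability.AlgebraicComplexity.DeterminantalComplexityProofs
import Literature.Computability.AlgebraicComplexity.PermanentVsDeterminant

/-!
# Crux `TwistedDetRank.FermionicNormalForm` (stmt-ValiantsHypothesis-6283) — typed decomposition
# through the VBP line (BC2 redirect; crux-strategist `cstrat-stmt-ValiantsHypothesis-6283-r1`)

The deciding crux X2 = `FermionicNormalForm` of route `TwistedDetRank` ("every p-computable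
class-function generalised matrix function `f_n = Σ_σ χ_n(σ) Π_i X_{σ(i),i}` is, for `n ≥ 1`, a sum
of quasi-polynomially many Hadamard-twisted determinants `det(X ∘ E_t)`") is at least the summit
(`valiantsHypothesis_of_fermionicNormalForm`, SummitHard), and its registered split A ∘ B has its
only open stub A summit-hard (`valiantsHypothesis_of_cheapClassFunctionsAreQuasiLocal`, Defs).
This file factors X2 through POLYNOMIALLY BOUNDED AFFINE DETERMINANTAL COMPLEXITY of the GMF
(the class `VBP = VP_ws`, Toda / Malod–Portier; tree notion `HasDetRepr`):

* §1 `SliceVPInVBP` (X2a, the COLLAPSE side): a p-computable class-function GMF family has affine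
  determinantal representations of p-bounded size — "the class-function slice of VP lies in VBP";
* §1 `SliceVBPFermionic` (X2b, the NORMAL-FORM side): a class-function GMF family with p-bounded
  `dc` is, for `n ≥ 1`, a sum of quasi-polynomially many twisted determinants — "fermionic normal
  form on the VBP slice";
* §2 the ASSEMBLY `fermionicNormalForm_of_subs : SliceVPInVBP → SliceVBPFermionic → X2`
  (composition; a trivial seam by design) and `valiantsHypothesis_of_subs`;
* §3 CALIBRATION of where the two pieces sit relative to the summit (kernel-checked):
  `dcPerSuperpolynomial_of_sliceVBPFermionic : SliceVBPFermionic → DcPerSuperpolynomial ℂ`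
  (X2b implies Valiant's determinantal hypothesis `VNP ⊄ VBP` over `ℂ`, via the landed exponential
  bound `tdr(per_{3m}) ≥ (3/2)^m` of `tdrPerNotQP_proof`), and
  `valiantsHypothesis_of_sliceVPInVBP_of_dcPerSuperpolynomial :
     SliceVPInVBP → DcPerSuperpolynomial ℂ → ValiantsHypothesis`
  (X2a is the summit RELATIVE TO `VNP ⊄ VBP`: it is exactly the statement "`VP = VBP` on the
  class-function slice", under which `VP ≠ VNP` and `VBP ≠ VNP` coincide).

WHY NEITHER PIECE IS THE SUMMIT (the point of the redirect).  `ValiantsHypothesis` fails in exactly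
two kinds of worlds: (W1) `VBP = VP = VNP` on the slice, and (W2) `VBP ⊊ VP = VNP` on the slice
(per p-computable but of superpolynomial `dc`).  X2a is consistent with W1 and excludes W2; X2b
(with the landed `tdr(per)` bound) is consistent with W2 and excludes W1.  So `X2a → VH` would be a
proof of `DcPerSuperpolynomial ℂ` (no superpolynomial `dc` lower bound is known for ANY explicit
family: `dc(per_n) ≥ n²/2`, Mignon–Ressayre 2004, is the record) and `X2b → VH` would be a proof of
`VP ⊆ VBP` on the slice; neither is available, and the cheap probes `Xᵢ → VH`, `Xᵢ → X2`
(`exact?` / `simpa` / `aesop`, with and without this crux's calibration theorems imported) all fail.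
The split is NOT re-mergeable by a uniform transfer: a bound `tdr ≤ T(dc)` with `T` monotone in
`dc` alone and `T(poly) ⊆ qp` forces `T(qp) ⊆ qp`, which with the PROVED `VP ⊆ VQP`-in-`dc`
(`isQPBounded_determinantalComplexity_of_isVPFamily_holds`, BCS97 (21.40)) would give X2 and hence
VH outright; the content of X2b is therefore a GRADED transfer (`dc ≤ n^k ⇒ tdr ≤ 2^{(log n)^{g(k)}}`,
the constant `c` of the conclusion depending on the exponent of the hypothesis), e.g. one obtained
by symmetrising a size-`n^k` determinantal representation over `S_n` at cost `n^{O(k)}` per level.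
The class-function hypothesis of X2b is load-bearing: without it X2b is FALSE by landed theorems
(`per₃^{⊕m}` has `dc = O(m)` and `tdr ≥ (3/2)^m`, `stub_conePowerRankThree`).

Sources: L. G. Valiant, STOC 1979; S. Toda, IEICE Trans. E75-D (1992); G. Malod, N. Portier,
J. Complexity 24 (2008) (VBP = p-bounded dc); T. Mignon, N. Ressayre, IMRN 2004 (dc(per) ≥ n²/2);
P. Bürgisser, *Completeness and Reduction in Algebraic Complexity Theory* (2000) §2.5, Ch. 7;
J. M. Landsberg, N. Ressayre, arXiv:1508.05788 (equivariant dc); A. Dawar, G. Wilsenach,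
arXiv:2002.06451 (symmetric circuits).  No named facts are assumed; nothing in §1 is claimed proved.
-/

-- single-conjunct layout: Sub = Summit, duplicated namespace component intended
set_option linter.dupNamespace false

noncomputable section

namespace Summit.ValiantsHypothesis.ValiantsHypothesis.Theorems.TwistedDetRankFermionicNormalForm

open Literature.Computability.AlgebraicComplexity
open Summit.ValiantsHypothesis.ValiantsHypothesis.Theses.TwistedDetRank
open scoped BigOperators

/-! ## §1 The two pieces -/

/-- **X2a — THE CLASS-FUNCTION SLICE OF VP LIES IN VBP** (collapse side; OPEN): if `χ_n` are class
functions on `S_n` and the GMF family `f_n = Σ_σ χ_n(σ) Π_i X_{σ(i),i}` is p-computable over `ℂ`,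
then `f_n` has affine determinantal representations of p-bounded size, `dc(f_n) ≤ n^c + c`.
Consistent with `VP ℂ = VNP ℂ` (world W1), so not the summit; every class-function GMF KNOWN to be
in VP is a short twisted-determinant sum and hence has polynomial `dc`.
[conjecture-grade: Burgisser2000 §2.5, MalodPortier2008, MignonRessayre2004] -/
def SliceVPInVBP : Prop :=
  ∀ χ : (n : ℕ) → Equiv.Perm (Fin n) → ℂ,
    (∀ (n : ℕ) (σ τ : Equiv.Perm (Fin n)), χ n (τ * σ * τ⁻¹) = χ n σ) →
    Literature.Computability.AlgebraicComplexity.IsPComputable (fun n => ∑ σ : Equiv.Perm (Fin n),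
      MvPolynomial.C (χ n σ) * ∏ i : Fin n, (MvPolynomial.X (σ i, i) : MvPolynomial (Fin n × Fin n) ℂ)) →
    ∃ c : ℕ, ∀ n : ℕ, ∃ m ≤ n ^ c + c,
      Literature.Computability.AlgebraicComplexity.HasDetRepr (∑ σ : Equiv.Perm (Fin n),
        MvPolynomial.C (χ n σ) * ∏ i : Fin n, (MvPolynomial.X (σ i, i) : MvPolynomial (Fin n × Fin n) ℂ)) m

/-- **X2b — FERMIONIC NORMAL FORM ON THE VBP SLICE** (normal-form side; OPEN): a class-function GMF
family with affine determinantal representations of p-bounded size is, for `n ≥ 1`, a sum of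
quasi-polynomially many Hadamard-twisted determinants `det(X ∘ E_t)`.  Implies
`DcPerSuperpolynomial ℂ` (§3) and is consistent with `VP ℂ = VNP ℂ` (world W2), so not the summit.
[conjecture-grade: LandsbergRessayre2017, DawarWilsenach2025, Curticapean2021, MarcusMinc1961] -/
def SliceVBPFermionic : Prop :=
  ∀ χ : (n : ℕ) → Equiv.Perm (Fin n) → ℂ,
    (∀ (n : ℕ) (σ τ : Equiv.Perm (Fin n)), χ n (τ * σ * τ⁻¹) = χ n σ) →
    (∃ c : ℕ, ∀ n : ℕ, ∃ m ≤ n ^ c + c,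
      Literature.Computability.AlgebraicComplexity.HasDetRepr (∑ σ : Equiv.Perm (Fin n),
        MvPolynomial.C (χ n σ) * ∏ i : Fin n, (MvPolynomial.X (σ i, i) : MvPolynomial (Fin n × Fin n) ℂ)) m) →
    ∃ c : ℕ, ∀ n : ℕ, 1 ≤ n → ∃ r ≤ 2 ^ ((Nat.log 2 n + c) ^ c), ∃ E : Fin r → Matrix (Fin n) (Fin n) ℂ,
      (∑ σ : Equiv.Perm (Fin n), MvPolynomial.C (χ n σ) *
          ∏ i : Fin n, (MvPolynomial.X (σ i, i) : MvPolynomial (Fin n × Fin n) ℂ)) =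
        ∑ t, (Matrix.of fun i j => MvPolynomial.C (E t i j) * MvPolynomial.X (i, j)).det

/-! ## §2 Assembly -/

/-- **ASSEMBLY of the redirect** `X2 ⇐ X2a ∧ X2b` (composition; trivial seam by design — the
content is in the placement of the cut, §3). [this file] -/
theorem fermionicNormalForm_of_subs : SliceVPInVBP → SliceVBPFermionic → FermionicNormalForm :=
  fun h1 h2 χ hχ hc => h2 χ hχ (h1 χ hχ hc)

/-- The same assembly with both pieces written out (no `def` of this file in the statement), for
gluing against route decls that restate the pieces verbatim. [this file] -/
theorem fermionicNormalForm_of_subs' :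
    (∀ χ : (n : ℕ) → Equiv.Perm (Fin n) → ℂ,
      (∀ (n : ℕ) (σ τ : Equiv.Perm (Fin n)), χ n (τ * σ * τ⁻¹) = χ n σ) →
      Literature.Computability.AlgebraicComplexity.IsPComputable (fun n => ∑ σ : Equiv.Perm (Fin n),
        MvPolynomial.C (χ n σ) * ∏ i : Fin n, (MvPolynomial.X (σ i, i) : MvPolynomial (Fin n × Fin n) ℂ)) →
      ∃ c : ℕ, ∀ n : ℕ, ∃ m ≤ n ^ c + c,
        Literature.Computability.AlgebraicComplexity.HasDetRepr (∑ σ : Equiv.Perm (Fin n),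
          MvPolynomial.C (χ n σ) * ∏ i : Fin n, (MvPolynomial.X (σ i, i) : MvPolynomial (Fin n × Fin n) ℂ)) m) →
    (∀ χ : (n : ℕ) → Equiv.Perm (Fin n) → ℂ,
      (∀ (n : ℕ) (σ τ : Equiv.Perm (Fin n)), χ n (τ * σ * τ⁻¹) = χ n σ) →
      (∃ c : ℕ, ∀ n : ℕ, ∃ m ≤ n ^ c + c,
        Literature.Computability.AlgebraicComplexity.HasDetRepr (∑ σ : Equiv.Perm (Fin n),
          MvPolynomial.C (χ n σ) * ∏ i : Fin n, (MvPolynomial.X (σ i, i) : MvPolynomial (Fin n × Fin n) ℂ)) m) →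
      ∃ c : ℕ, ∀ n : ℕ, 1 ≤ n → ∃ r ≤ 2 ^ ((Nat.log 2 n + c) ^ c), ∃ E : Fin r → Matrix (Fin n) (Fin n) ℂ,
        (∑ σ : Equiv.Perm (Fin n), MvPolynomial.C (χ n σ) *
            ∏ i : Fin n, (MvPolynomial.X (σ i, i) : MvPolynomial (Fin n × Fin n) ℂ)) =
          ∑ t, (Matrix.of fun i j => MvPolynomial.C (E t i j) * MvPolynomial.X (i, j)).det) →
    FermionicNormalForm :=
  fermionicNormalForm_of_subs

/-- The two pieces decide the summit (through the route's deciding theorem `closes` and the proved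
crux X1 `tdrPerNotQP_proof`). [this file] -/
theorem valiantsHypothesis_of_subs : SliceVPInVBP → SliceVBPFermionic → _root_.ValiantsHypothesis :=
  fun h1 h2 => closes tdrPerNotQP_proof (fermionicNormalForm_of_subs h1 h2)

/-! ## §3 Calibration: where the pieces sit -/

/-- `per_n` is the generalised matrix function of the class function `χ ≡ 1`. [folklore] -/
theorem gmf_one_eq_perPoly (n : ℕ) :
    (∑ σ : Equiv.Perm (Fin n), MvPolynomial.C (1 : ℂ) *
        ∏ i : Fin n, (MvPolynomial.X (σ i, i) : MvPolynomial (Fin n × Fin n) ℂ)) =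
      perPoly (Fin n) ℂ := by
  simp [perPoly, Matrix.permanent]

/-- **X2b implies Valiant's determinantal hypothesis `VNP ⊄ VBP` over `ℂ`** (`DcPerSuperpolynomial ℂ`:
`dc(per_n)` is not p-bounded): a p-bounded `dc(per_n)` is a p-bounded affine representation of the
GMF of `χ ≡ 1` (`hasDetRepr_determinantalComplexity_holds`), which X2b turns into a quasi-polynomial
twisted representation of `per_n` for `n ≥ 1` (`n = 0`: one empty determinant), contradicting the
proved crux X1 (`tdrPerNotQP_proof`: `tdr(per_{3m}) ≥ (3/2)^m`).  So X2b is at least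
`VBP ≠ VNP`-hard — and NOT known to be `VP ≠ VNP`-hard: it is consistent with world W2.
[this file; MignonRessayre2004, MalodPortier2008] -/
theorem dcPerSuperpolynomial_of_sliceVBPFermionic :
    SliceVBPFermionic → DcPerSuperpolynomial ℂ := by
  intro hX2b hpb
  obtain ⟨c, hc⟩ := hpb
  have hyp : ∃ c : ℕ, ∀ n : ℕ, ∃ m ≤ n ^ c + c,
      HasDetRepr (∑ σ : Equiv.Perm (Fin n), MvPolynomial.C (1 : ℂ) *
        ∏ i : Fin n, (MvPolynomial.X (σ i, i) : MvPolynomial (Fin n × Fin n) ℂ)) m := by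
    refine ⟨c, fun n => ⟨determinantalComplexity (perPoly (Fin n) ℂ), hc n, ?_⟩⟩
    rw [gmf_one_eq_perPoly]
    exact hasDetRepr_determinantalComplexity_holds _
  obtain ⟨c', hc'⟩ := hX2b (fun _ _ => (1 : ℂ)) (fun _ _ _ => rfl) hyp
  apply tdrPerNotQP_proof
  refine ⟨c', fun n => ?_⟩
  rcases Nat.eq_zero_or_pos n with rfl | hn
  · refine ⟨1, Nat.one_le_two_pow, fun _ => 0, ?_⟩
    simp [perPoly, Matrix.permanent_isEmpty, Matrix.det_isEmpty]
  · obtain ⟨r, hr, E, hE⟩ := hc' n hn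
    exact ⟨r, hr, E, (gmf_one_eq_perPoly n).symm.trans hE⟩

/-- **X2a is the summit RELATIVE TO `VNP ⊄ VBP`**: if the class-function slice of VP lies in VBP
and `dc(per_n)` is not p-bounded, then `VP ℂ ≠ VNP ℂ` (under `VP = VNP` the permanent family is
p-computable, `isPComputable_perPoly_complex_iff`; it is the GMF of `χ ≡ 1`; X2a bounds its `dc`
polynomially, `determinantalComplexity_le_of_hasDetRepr`).  Read contrapositively: a proof of
`X2a → ValiantsHypothesis` not using `DcPerSuperpolynomial ℂ` is not in sight, and X2a is consistent
with world W1 (`VBP = VP = VNP`). [this file; Burgisser2000 Rem. 2.11] -/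
theorem valiantsHypothesis_of_sliceVPInVBP_of_dcPerSuperpolynomial :
    SliceVPInVBP → DcPerSuperpolynomial ℂ → _root_.ValiantsHypothesis := by
  intro hX2a hdc
  show VP ℂ ≠ VNP ℂ
  intro hEq
  have hper : IsPComputable (fun n => perPoly (Fin n) ℂ) :=
    isPComputable_perPoly_complex_iff.2 hEq
  have hfun : (fun n => ∑ σ : Equiv.Perm (Fin n), MvPolynomial.C (1 : ℂ) *
        ∏ i : Fin n, (MvPolynomial.X (σ i, i) : MvPolynomial (Fin n × Fin n) ℂ)) =
      (fun n => perPoly (Fin n) ℂ) := funext gmf_one_eq_perPoly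
  have hcomp : IsPComputable (fun n => ∑ σ : Equiv.Perm (Fin n), MvPolynomial.C (1 : ℂ) *
        ∏ i : Fin n, (MvPolynomial.X (σ i, i) : MvPolynomial (Fin n × Fin n) ℂ)) := by
    rw [hfun]; exact hper
  obtain ⟨c, hc⟩ := hX2a (fun _ _ => (1 : ℂ)) (fun _ _ _ => rfl) hcomp
  apply hdc
  refine ⟨c, fun n => ?_⟩
  obtain ⟨m, hm, hA⟩ := hc n
  rw [gmf_one_eq_perPoly] at hA
  exact (determinantalComplexity_le_of_hasDetRepr hA).trans hm

/-- The summit from the two pieces, factored through `VNP ⊄ VBP` (the informal content of the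
redirect: `VH ⇐ (VP ⊆ VBP on the slice) ∧ (VBP slice is fermionic ⟹ VNP ⊄ VBP)`). [this file] -/
theorem valiantsHypothesis_of_subs' : SliceVPInVBP → SliceVBPFermionic → _root_.ValiantsHypothesis :=
  fun h1 h2 => valiantsHypothesis_of_sliceVPInVBP_of_dcPerSuperpolynomial h1
    (dcPerSuperpolynomial_of_sliceVBPFermionic h2)

end Summit.ValiantsHypothesis.ValiantsHypothesis.Theorems.TwistedDetRankFermionicNormalForm

end
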